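import Mathlib
import HarnessLib
import Summits.HubbardSuperconductivity.HubbardSuperconductivity.Theorems.KLProgrammeC4aPPKernelFamilySecond
import Summits.HubbardSuperconductivity.HubbardSuperconductivity.Theorems.KLProgrammeC4aPPKernelFamilyNeg

/-!
# Route `KLProgramme` — crux C4a, S3 brick (B4) «(B4)-UMK1», «(M1)-FAMILY» part 5: the NORMALISED kernel rows — for `Kr(e,u) := ppFamilyKernel β Λ κ lo e u / C` with
# `C` above the row constants, the thirteen kernel rows of `…C4aFoldBoxLawRowsAbs.foldBox_law_rows_abs` in its binder shapes (unit envelopes)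

Cell `gate-hubbard-kl`, seat hubbard-kl-k3c3-p1 (g16; row «δμ-flow with klAngularMean constant piece»).  The (C)-closer's one-call kernel input for the primed
near-caustic box `…C4aNearCausticBoxAbs.nearCausticBox_integral_abs_le` (stmt-HubbardSuperconductivity-20437 (C)/(U1)); memo
HOME/hubbard-kl-k3c3-p1/g16-M1-NEG-PRE-KERNEL.md §7–§8.  Standing data: `0 < β`, `0 < Λ`, `|χ′| ≤ B₁`, `|χ″| ≤ B₂`; split profile `HasDerivAt κ κ′`, `HasDerivAt κ′ κ″`,
`κ″` continuous, `|κ|,|κ′|,|κ″| ≤ κ₀,κ₁,κ₂` on `[0,1]`, `κ = κ′ = κ″ = 0` on `[t₁,∞)`, `0 < t₁ ≤ 2/5`; floor `0 < lo ≤ Λ`; normalisation `C > 0` with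
`κ₀(12B₁+9) ≤ C`, `C₁ᶠ ≤ C`, `C₂ᶠ ≤ C`, `Cˢ ≤ C` (the `hK0/hK1/hK2/hKs1` constants of parts 1, 4).
* §1 scaling identities (`deriv`, `iteratedDeriv 2` of `Kr/C`);
* §2 the rows: **`familyRow_hKd`**, **`familyRow_hK2d`**, **`familyRow_hK0`**, **`familyRow_hK1`**, **`familyRow_hK2`**, **`familyRow_hsupp`** (`q_s = (1−t₁)/t₁`), **`familyRow_hKc`**,
  **`familyRow_hKn1`** (`ρm = ρᶠ/C`), **`familyRow_hρ0/hρc/hρtail`** (`Mρ = Mρᶠ/C`), **`familyRow_hKs1`**, **`familyRow_hflat`** (`0 < D ≤ hi/t₁`, Lipschitz weight: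
  `≤ Afl·lo/max(D,lo)² + Bfl`, `Afl = W(A₁Λ/lo + C₁(1−t₁)⁻²)/C`, `Bfl = W′C₁t₁²(1−t₁)⁻²/C`).
Pure real analysis on Literature objects; nothing asserts (C), K3, the window or superconductivity.
References: BGM 2006 §2.4 (2.36) [cite: BenfattoGiulianiMastropietro2006]; FST II CPAM 51 (1998) §3 [cite: FeldmanSalmhoferTrubowitz1998].
-/

noncomputable section

namespace Summit.HubbardSuperconductivity.HubbardSuperconductivity.Theorems.C4a

set_option linter.dupNamespace false -- summit = problem name (single-conjunct summit), D-0017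

open Real Filter Set MeasureTheory intervalIntegral
open scoped Topology Interval
open Literature.MathematicalPhysics.QuantumLattice Literature.Analysis.SpecialFunctions

/-! ## §1 Scaling -/

/-- `deriv (Kr e / C) = deriv (Kr e) / C`. [folklore] -/
theorem deriv_ppFamilyKernel_div (β Λ : ℝ) (κ : ℝ → ℝ) (lo C e u : ℝ) :
    deriv (fun v : ℝ => ppFamilyKernel β Λ κ lo e v / C) u = deriv (fun v : ℝ => ppFamilyKernel β Λ κ lo e v) u / C :=
  deriv_div_const C

/-- `iteratedDeriv 2 (Kr e / C) = iteratedDeriv 2 (Kr e) / C`. [folklore] -/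
theorem iteratedDeriv_two_ppFamilyKernel_div (β Λ : ℝ) (κ : ℝ → ℝ) (lo C e u : ℝ) :
    iteratedDeriv 2 (fun v : ℝ => ppFamilyKernel β Λ κ lo e v / C) u = iteratedDeriv 2 (fun v : ℝ => ppFamilyKernel β Λ κ lo e v) u / C :=
  iteratedDeriv_div_const _ C

/-- A bound `|x| ≤ A·q` with `A ≤ C`, `0 < C`, `0 ≤ q` gives `|x/C| ≤ q`. [folklore] -/
theorem abs_div_le_of_le {x A C q : ℝ} (hx : |x| ≤ A * q) (hAC : A ≤ C) (hC : 0 < C) (hq : 0 ≤ q) : |x / C| ≤ q := by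
  rw [abs_div, abs_of_pos hC, div_le_iff₀ hC]
  calc |x| ≤ A * q := hx
    _ ≤ C * q := mul_le_mul_of_nonneg_right hAC hq
    _ = q * C := mul_comm _ _

section Rows

variable {β Λ : ℝ} (hβ : 0 < β) (hΛ : 0 < Λ) {B₁ B₂ : ℝ} (hB₁ : ∀ x, |deriv salmhoferCutoff x| ≤ B₁) (hB₂ : ∀ x, |deriv (deriv salmhoferCutoff) x| ≤ B₂)
  {κ κ' κ'' : ℝ → ℝ} (hκ : ∀ t, HasDerivAt κ (κ' t) t) (hκ' : ∀ t, HasDerivAt κ' (κ'' t) t) (hκ''c : Continuous κ'')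
  {κ₀ κ₁ κ₂ : ℝ} (hκb : ∀ t ∈ Icc 0 1, |κ t| ≤ κ₀) (hκ'b : ∀ t ∈ Icc 0 1, |κ' t| ≤ κ₁) (hκ''b : ∀ t ∈ Icc 0 1, |κ'' t| ≤ κ₂)
  {t₁ : ℝ} (ht₀ : 0 < t₁) (ht25 : t₁ ≤ 2 / 5) (hκs : ∀ t, t₁ ≤ t → κ t = 0) (hκ's : ∀ t, t₁ ≤ t → κ' t = 0) (hκ''s : ∀ t, t₁ ≤ t → κ'' t = 0)
  {lo hi C : ℝ} (hlo : 0 < lo) (hloΛ : lo ≤ Λ) (hC : 0 < C)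

/-! ## §2 The rows of `foldBox_law_rows_abs` for `Kr := ppFamilyKernel/C` -/

include hβ hΛ hB₁ hκ hκ' ht25 hκs hlo in
/-- **ROW `hKd`.** [cite: BenfattoGiulianiMastropietro2006, §2.4 (2.36)] -/
theorem familyRow_hKd : ∀ e ∈ Icc (-hi) hi, e ≠ 0 → ContDiff ℝ 1 (fun v : ℝ => ppFamilyKernel β Λ κ lo e v / C) := fun e _ _ => by
  have hκ'c : Continuous κ' := continuous_iff_continuousAt.2 fun t => (hκ' t).continuousAt
  exact (contDiff_one_ppFamilyKernel hβ hΛ hB₁ hκ hκ'c (by linarith) hκs hlo e).div_const C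

include hβ hΛ hB₁ hB₂ hκ hκ' hκ''c ht₀ ht25 hκs hκ's hκ''s hlo in
/-- **ROW `hK2d`.** [cite: BenfattoGiulianiMastropietro2006, §2.4 (2.36)] -/
theorem familyRow_hK2d : ∀ e ∈ Icc lo hi, ContDiff ℝ 2 (fun v : ℝ => ppFamilyKernel β Λ κ lo e v / C) := fun _ he =>
  (contDiff_two_ppFamilyKernel hβ hΛ hB₁ hB₂ hκ hκ' hκ''c ht₀ ht25 hκs hκ's hκ''s hlo he.1).div_const C

include hβ hΛ hB₁ hκb hlo hC in
/-- **ROW `hK0`** (`κ₀(12B₁+9) ≤ C`). [cite: BenfattoGiulianiMastropietro2006, §2.4 (2.36)] -/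
theorem familyRow_hK0 (hC0 : κ₀ * (12 * B₁ + 9) ≤ C) :
    ∀ e ∈ Icc (-hi) hi, e ≠ 0 → ∀ u, |ppFamilyKernel β Λ κ lo e u / C| ≤ (max |e| |u|)⁻¹ := fun e _ he u =>
  abs_div_le_of_le (abs_ppFamilyKernel_le hβ hΛ hB₁ hκb hlo he u) hC0 hC (by positivity)

include hβ hΛ hB₁ hB₂ hκ hκb hκ'b ht₀ ht25 hκs hlo hC in
/-- **ROW `hK1`** (`C₁ᶠ = κ₀(64B₂+96B₁+136+(12B₁+9)/min(1,(1−t₁)/t₁)) + κ₁(12B₁+9) ≤ C`). [cite: BenfattoGiulianiMastropietro2006, §2.4 (2.36)] -/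
theorem familyRow_hK1 (hC1 : κ₀ * (64 * B₂ + 96 * B₁ + 136 + (12 * B₁ + 9) / min 1 ((1 - t₁) / t₁)) + κ₁ * (12 * B₁ + 9) ≤ C) :
    ∀ e ∈ Icc (-hi) hi, e ≠ 0 → ∀ u, |deriv (fun v : ℝ => ppFamilyKernel β Λ κ lo e v / C) u| ≤ (max |e| |u|)⁻¹ ^ 2 := fun e _ he u => by
  rw [deriv_ppFamilyKernel_div]
  exact abs_div_le_of_le (abs_deriv_ppFamilyKernel_le hβ hΛ hB₁ hB₂ hκ hκb hκ'b ht₀ (by linarith) hκs hlo he u) hC1 hC (by positivity)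

include hβ hΛ hB₁ hB₂ hκ hκ' hκb hκ'b hκ''b ht₀ ht25 hκs hκ's hκ''s hlo hC in
/-- **ROW `hK2`** (`C₂ᶠ = C₂⁺ + C₂₋ ≤ C`). [cite: BenfattoGiulianiMastropietro2006, §2.4 (2.36)] -/
theorem familyRow_hK2
    (hC2 : (κ₀ * ((16 * B₂ + 24 * B₁ + 33) / (1 - t₁) ^ 2) + 2 * (κ₀ + κ₁) * ((6 * B₁ + 5 / 2) / (1 - t₁)) + (2 * κ₀ + 4 * κ₁ + κ₂)) +
        (3 * κ₀ * (16 * B₂ + 24 * B₁ + 33) + 2 * (6 * B₁ + 9 / 2) * (3 * κ₁ + 9 * κ₀) + (3 * κ₂ + 24 * κ₁ + 54 * κ₀)) ≤ C) :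
    ∀ e ∈ Icc lo hi, ∀ u, |iteratedDeriv 2 (fun v : ℝ => ppFamilyKernel β Λ κ lo e v / C) u| ≤ (max e |u|)⁻¹ ^ 3 := fun e he u => by
  rw [iteratedDeriv_two_ppFamilyKernel_div]
  have he0 : 0 < e := hlo.trans_le he.1
  exact abs_div_le_of_le (abs_iteratedDeriv_two_ppFamilyKernel_le hβ hΛ hB₁ hB₂ hκ hκ' hκb hκ'b hκ''b ht₀ ht25 hκs hκ's hκ''s hlo he.1 u) hC2 hC
    (by positivity)

include hβ hΛ hB₁ hκ ht₀ ht25 hκs hκ's hlo in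
/-- **ROW `hsupp`** in the two-sided form with `q_s = (1−t₁)/t₁` (`≥ 3/2`). [cite: BenfattoGiulianiMastropietro2006, §2.4 (2.36)] -/
theorem familyRow_hsupp : ∀ e ∈ Icc lo hi, ∀ u, |u| ≤ (1 - t₁) / t₁ * e → deriv (fun v : ℝ => ppFamilyKernel β Λ κ lo e v / C) u = 0 := fun e he u hu => by
  rw [deriv_ppFamilyKernel_div, deriv_ppFamilyKernel_eq_zero_of_abs_le hβ hΛ hB₁ hκ ht₀ ht25 hκs hκ's hlo he.1 hu, zero_div]

/-- `q_s = (1−t₁)/t₁ ≥ 3/2` for `0 < t₁ ≤ 2/5`. [folklore] -/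
theorem familyRow_qs_ge {t₁ : ℝ} (ht₀ : 0 < t₁) (ht25 : t₁ ≤ 2 / 5) : 3 / 2 ≤ (1 - t₁) / t₁ := by
  rw [le_div_iff₀ ht₀]; linarith

include hβ hΛ hB₁ hκ ht25 hκs hκ's hlo in
/-- **ROW `hKc`**: joint continuity of the normalised family's partner derivative. [cite: BenfattoGiulianiMastropietro2006, §2.4 (2.36)] -/
theorem familyRow_hKc (hκ'c : Continuous κ') : Continuous fun p : ℝ × ℝ => deriv (fun v : ℝ => ppFamilyKernel β Λ κ lo p.1 v / C) p.2 := by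
  have h : (fun p : ℝ × ℝ => deriv (fun v : ℝ => ppFamilyKernel β Λ κ lo p.1 v / C) p.2) =
      fun p => deriv (fun v : ℝ => ppFamilyKernel β Λ κ lo p.1 v) p.2 / C := funext fun p => deriv_ppFamilyKernel_div β Λ κ lo C p.1 p.2
  rw [h]
  exact (continuous_deriv_ppFamilyKernel₂ hβ hΛ hB₁ hκ hκ'c (by linarith) hκs hκ's hlo).div_const C

include hβ hΛ hB₁ hB₂ hκ hκb hκ'b ht25 hκs hlo hC in
/-- **ROW `hKn1`** with `ρm = ρᶠ/C`. [cite: BenfattoGiulianiMastropietro2006, §2.4 (2.36)] -/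
theorem familyRow_hKn1 : ∀ s ∈ Icc lo hi, ∀ u, s / 2 ≤ u →
    |deriv (fun v : ℝ => ppFamilyKernel β Λ κ lo (-s) v / C) u| ≤
      (64 * (κ₀ * (64 * B₂ + 120 * B₁ + 154) + κ₁ * (12 * B₁ + 9)) * Λ ^ 3 / (s + 2 * Λ) ^ 3 +
          (κ₀ * ((β * lo) ^ 2 + 2) + κ₁ * (β * lo + 1)) * Real.exp (-(β / 2 * s))) / C * ((max (u - s) lo)⁻¹ ^ 2) := fun s hs u hu => by
  rw [deriv_ppFamilyKernel_div, abs_div, abs_of_pos hC, div_mul_eq_mul_div]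
  exact div_le_div_of_nonneg_right (abs_deriv_ppFamilyKernel_negLevel_row hβ hΛ hB₁ hB₂ hκ hκb hκ'b (by linarith) hκs hlo s hs u hu) hC.le

include hβ hΛ hC in
/-- **ROW `hρ0`** for `ρm = ρᶠ/C`. [folklore] -/
theorem familyRow_hρ0 (hB10 : 0 ≤ B₁) (hB20 : 0 ≤ B₂) (hκ₀ : 0 ≤ κ₀) (hκ₁ : 0 ≤ κ₁) (hlo : 0 < lo) : ∀ s ∈ Icc lo hi,
    0 ≤ (64 * (κ₀ * (64 * B₂ + 120 * B₁ + 154) + κ₁ * (12 * B₁ + 9)) * Λ ^ 3 / (s + 2 * Λ) ^ 3 +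
      (κ₀ * ((β * lo) ^ 2 + 2) + κ₁ * (β * lo + 1)) * Real.exp (-(β / 2 * s))) / C := fun _ hs =>
  div_nonneg (familyMajorant_nonneg hβ hΛ hB10 hB20 hκ₀ hκ₁ hlo (hlo.le.trans hs.1)) hC.le

include hΛ in
/-- **ROW `hρc`** for `ρm = ρᶠ/C`. [folklore] -/
theorem familyRow_hρc (hlo : 0 < lo) : ContinuousOn (fun s : ℝ =>
    (64 * (κ₀ * (64 * B₂ + 120 * B₁ + 154) + κ₁ * (12 * B₁ + 9)) * Λ ^ 3 / (s + 2 * Λ) ^ 3 +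
      (κ₀ * ((β * lo) ^ 2 + 2) + κ₁ * (β * lo + 1)) * Real.exp (-(β / 2 * s))) / C) (Icc lo hi) :=
  (continuousOn_familyMajorant (β := β) (B₁ := B₁) (B₂ := B₂) (κ₀ := κ₀) (κ₁ := κ₁) (hi := hi) hΛ hlo).div_const C

include hβ hΛ hC in
/-- **ROW `hρtail`** with `Mρ = Mρᶠ/C`. [folklore] -/
theorem familyRow_hρtail (hB10 : 0 ≤ B₁) (hB20 : 0 ≤ B₂) (hκ₀ : 0 ≤ κ₀) (hκ₁ : 0 ≤ κ₁) (hlo : 0 < lo) : ∀ a ∈ Icc lo hi,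
    ∫ s in a..hi, (64 * (κ₀ * (64 * B₂ + 120 * B₁ + 154) + κ₁ * (12 * B₁ + 9)) * Λ ^ 3 / (s + 2 * Λ) ^ 3 +
        (κ₀ * ((β * lo) ^ 2 + 2) + κ₁ * (β * lo + 1)) * Real.exp (-(β / 2 * s))) / C ≤
      (32 * (κ₀ * (64 * B₂ + 120 * B₁ + 154) + κ₁ * (12 * B₁ + 9)) * (Λ / lo) ^ 3 +
          32 * (κ₀ * ((β * lo) ^ 2 + 2) + κ₁ * (β * lo + 1)) / (β * lo) ^ 3) / C * (lo * (lo / a) ^ 2) := fun a ha => by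
  rw [intervalIntegral.integral_div, div_mul_eq_mul_div]
  exact div_le_div_of_nonneg_right (intervalIntegral_familyMajorant_tail_le hβ hΛ hB10 hB20 hκ₀ hκ₁ hlo a ha) hC.le

include hβ hΛ hB₁ hκ hκb hκ'b ht25 hκs hlo hloΛ hC in
/-- **ROW `hKs1`** (`Cˢ = κ₀(128B₁+72) + 8κ₁ ≤ C`). [cite: BenfattoGiulianiMastropietro2006, §2.4 (2.36)] -/
theorem familyRow_hKs1 (hCs : κ₀ * (128 * B₁ + 72) + 8 * κ₁ ≤ C) :
    ∀ e ∈ Icc (-lo) lo, ∀ u, |deriv (fun v : ℝ => ppFamilyKernel β Λ κ lo e v / C) u| ≤ (max lo |u|)⁻¹ ^ 2 := fun e he u => by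
  rw [deriv_ppFamilyKernel_div]
  exact abs_div_le_of_le (abs_deriv_ppFamilyKernel_strip_row hβ hΛ hB₁ hκ hκb hκ'b (by linarith) hκs hlo hloΛ e he u) hCs hC (by positivity)

include hβ hΛ hB₁ hκ hκb hκ'b ht₀ ht25 hκs hκ's hlo hloΛ hC in
/-- **ROW `hflat` (box form)**: `lo ≤ hi`, `wt` continuous on `[lo,hi]`, `|wt| ≤ W`, `|wt e − wt lo| ≤ W′(e−lo)` (`W′ ≥ 0`), `0 < D ≤ hi/t₁` ⟹
`|∫_{lo..hi} wt·deriv(Kr e/C)(D−e)| ≤ Afl·(lo/max(D,lo)²) + Bfl`, `Afl = W(A₁Λ/lo + C₁(1−t₁)⁻²)/C`, `Bfl = W′C₁t₁²(1−t₁)⁻²/C`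
(`A₁`, `C₁` of `…OneSidedFlatness`; `Λ/max(D,Λ)² ≤ (Λ/lo)·lo/max(D,lo)²` for `lo ≤ Λ`). [cite: FeldmanSalmhoferTrubowitz1998, §3] -/
theorem familyRow_hflat (hκ'c : Continuous κ') (hlohi : lo ≤ hi) {wt : ℝ → ℝ} {W W' : ℝ} (hwc : ContinuousOn wt (Icc lo hi))
    (hwW : ∀ e ∈ Icc lo hi, |wt e| ≤ W) (hW' : 0 ≤ W') (hwL : ∀ e ∈ Icc lo hi, |wt e - wt lo| ≤ W' * (e - lo)) {D : ℝ} (hD : 0 < D) (hDhi : D ≤ hi / t₁) :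
    |∫ e in lo..hi, wt e * deriv (fun v : ℝ => ppFamilyKernel β Λ κ lo e v / C) (D - e)| ≤
      W * (((6 * B₁ + 5 / 2) * (2 * κ₀ + κ₁) * (4 / (1 - t₁) ^ 2) + κ₀ * (10 * B₁ + 7 / 2 + 2 / (β * Λ) + 1 / (1 - t₁))) * (Λ / lo) +
            (κ₀ * ((6 * B₁ + 5 / 2) / (1 - t₁)) + κ₀ + κ₁) / (1 - t₁) ^ 2) / C * (lo / max D lo ^ 2) +
        W' * (κ₀ * ((6 * B₁ + 5 / 2) / (1 - t₁)) + κ₀ + κ₁) * t₁ ^ 2 / (1 - t₁) ^ 2 / C := by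
  have hB0 := salmhoferB₁_nonneg hB₁
  have h1t : 0 < 1 - t₁ := by linarith
  have hκ₀ : 0 ≤ κ₀ := (abs_nonneg _).trans (hκb 0 (left_mem_Icc.2 zero_le_one))
  have hκ₁ : 0 ≤ κ₁ := (abs_nonneg _).trans (hκ'b 0 (left_mem_Icc.2 zero_le_one))
  have hW0 : 0 ≤ W := (abs_nonneg _).trans (hwW lo (left_mem_Icc.2 hlohi))
  -- pull `1/C` out of the integral
  have hfun : (fun e => wt e * deriv (fun v : ℝ => ppFamilyKernel β Λ κ lo e v / C) (D - e)) =
      fun e => (wt e * deriv (fun v : ℝ => ppFamilyKernel β Λ κ lo e v) (D - e)) / C := funext fun e => by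
    rw [deriv_ppFamilyKernel_div]; ring
  rw [hfun, intervalIntegral.integral_div, abs_div, abs_of_pos hC]
  have h := abs_intervalIntegral_box_flatness_family_le hβ hΛ hB₁ hκ hκ'c hκb hκ'b ht₀ ht25 hκs hκ's hlo hlohi hwc hwW hW' hwL hD hDhi
  -- `Λ/max(D,Λ)² ≤ (Λ/lo)·(lo/max(D,lo)²)`
  have hmaxD : 0 < max D lo := lt_max_of_lt_left hD
  have hmaxΛ : 0 < max D Λ := lt_max_of_lt_left hD
  have hcmp : Λ / max D Λ ^ 2 ≤ Λ / lo * (lo / max D lo ^ 2) := by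
    have hmm : max D lo ≤ max D Λ := max_le_max le_rfl hloΛ
    rw [show Λ / lo * (lo / max D lo ^ 2) = Λ / max D lo ^ 2 by field_simp]
    exact div_le_div_of_nonneg_left hΛ.le (by positivity) (pow_le_pow_left₀ hmaxD.le hmm 2)
  set A₁ : ℝ := (6 * B₁ + 5 / 2) * (2 * κ₀ + κ₁) * (4 / (1 - t₁) ^ 2) + κ₀ * (10 * B₁ + 7 / 2 + 2 / (β * Λ) + 1 / (1 - t₁)) with hA₁
  set C₁ : ℝ := κ₀ * ((6 * B₁ + 5 / 2) / (1 - t₁)) + κ₀ + κ₁ with hC₁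
  have hA₁0 : 0 ≤ A₁ := by positivity
  have hC₁0 : 0 ≤ C₁ := by positivity
  have h2 : W * (A₁ * (Λ / max D Λ ^ 2) + C₁ / (1 - t₁) ^ 2 * (lo / max D lo ^ 2)) + W' * C₁ * t₁ ^ 2 / (1 - t₁) ^ 2 ≤
      W * (A₁ * (Λ / lo) + C₁ / (1 - t₁) ^ 2) * (lo / max D lo ^ 2) + W' * C₁ * t₁ ^ 2 / (1 - t₁) ^ 2 := by
    have h3 : A₁ * (Λ / max D Λ ^ 2) ≤ A₁ * (Λ / lo * (lo / max D lo ^ 2)) := mul_le_mul_of_nonneg_left hcmp hA₁0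
    nlinarith [mul_le_mul_of_nonneg_left h3 hW0]
  rw [div_le_iff₀ hC]
  refine (h.trans h2).trans (le_of_eq ?_)
  field_simp

end Rows

end Summit.HubbardSuperconductivity.HubbardSuperconductivity.Theorems.C4a

end
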